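import Summits.HodgeConjecture.HodgeConjecture.Theorems.PadicSemiregularLiftHodgeFermatVarietiesFibreOfTopLevelGeneralTwin

/-!
# GP without the twin exclusion, VII — `PairedNull.exists_fibre_of_not_paired_general₂` (GP-L2 with `(p₁+2)² ∤ m`)

Part 7 of 9 (Sketch Part 2, ll. 1549–1676; TREE namespace `…CancelByAnyClaimLattice.PairedNull`): **`exists_fibre_of_not_paired_general₂`** — c4's
`stub_exists_fibre_of_not_paired_general` verbatim on top of `fibre_of_top_level_general₂`: a non-paired Hodge `(p₁+1)`-multiset at a level of least prime
`p₁ ≥ 11` with `p₁² ∤ m`, `(p₁+2)² ∤ m` contains a full fibre (an Aoki progression).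

PROVENANCE. Cell hodge-nonav (HUMAN RULING D-0038), planner seat p1 g33: chapter ROUTE-P1AF addenda ADD4 ∕ ADD5 (memos `HOME/memos/ROUTE-P1AF-ADD4.md`
b7ad80a65555c84d, `…-ADD5.md` ffaf9911041dfeba; referee PASS 0∕0: ref g52 REF-P1AF-ADD4.md 83f6fe06da4ed38e, ref g53 REF-P1AF-ADD5.md bcccb0bceb665800),
frozen Sketch `HOME/p1/route/Sketch_P1AF_RGENTWIN_g33.lean` (sha16 596f05bb769cab0c, 1805 lines, namespaces `HodgeNonAV.P1AF.GenTwin` + the line's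
`…CancelByAnyClaimLattice.PairedNull ∕ .CoprimeSix`, farm rc 0 / 0 sorries / axioms {propext, Classical.choice, Quot.sound}; re-elaborated 2026-08-28), split into
nine tree modules `…GeneralTwinSplit` → `…GeneralTwinLocal` → `…GeneralTwinLevel` → `…GeneralTwinLevelOne` → `…GeneralTwinGlue` → `…FibreOfTopLevelGeneralTwinKey` → `…FibreOfTopLevelGeneralTwin` →
`…FibreOfProgressionGeneralTwin` → `…GeneralTwinPayoff` by planner p1 g34 (landing kit HOME/p1/landing/); proof bodies verbatim (cell namespace renamed
`…Theorems.CancelByAnyClaimLattice.GenTwin`); docstrings reworded per referee rider N-ADD4-1 (Aoki 1983 cites are METHOD attributions; the statements without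
the twin exclusion are not in print). Target: lead c4's `CoprimeSix.hodgeConjectureFor_general` (`Theorems/…GeneralPayoff`) WITHOUT the hypothesis
`htwin : ¬ p₁ (p₁+2) ∣ m` — replaced by `(p₁+2)² ∤ m`. Land with `--supports stmt-HodgeConjecture-1334` (line `cancel-by-any-claim-lattice` of crux
`HodgeFermatVarieties`, route `PadicSemiregularLift`). No instance, no new notation (the `local notation3` of Parts 2, 3 and 9 are the line's, verbatim from
`Theorems/PadicSemiregularLiftHodgeFermatVarietiesFibreOfBoundaryPow` ∕ `…GeneralPayoff`), no sorry, no new axiom.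
HONEST SCOPE: the HC pay-off `hodgeConjectureFor_general₂` is MODULO the line's named facts (S0) and stub statements (S2↑, S2↓, S3a, S5), exactly as c4's
`hodgeConjectureFor_general`; Fermat varieties are dominated by abelian motives (inside the known AV region); NOTHING here proves the Hodge conjecture.
References (method): N. Aoki, Math. Ann. 266 (1983) Thm A′ (§7), Prop. 2.2, Prop. 6.4, §9 [cite: Aoki1983, Thm. A]; N. Aoki, J. Math. Soc. Japan 39 (1987)
Thm 1-1, Thm 2-1 [cite: Aoki1987, Thm. 2-1]; T. Shioda, Proc. Japan Acad. 55 (1979) §2 Thm 1 [cite: Shioda1979PJA, Thm. 1].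
-/

set_option linter.dupNamespace false

noncomputable section

open Finset
open Literature.AlgebraicGeometry.HodgeTheory Literature.AlgebraicGeometry.HodgeTheory.FermatCharacter
open Summit.HodgeConjecture.HodgeConjecture.Theorems.CancelByAnyClaimLattice
open Summit.HodgeConjecture.HodgeConjecture.Theorems.CancelByAnyClaimLattice.PairedNull

namespace Summit.HodgeConjecture.HodgeConjecture.Theorems.CancelByAnyClaimLattice

namespace PairedNull


section ProgressionGeneralTwin

/-- **GP-L2 without the twin exclusion** (`p₁ ≥ 11`, `(p₁+2)² ∤ m`): c4's `stub_exists_fibre_of_not_paired_general` verbatim on top of `fibre_of_top_level_general₂`. (method after (method after [cite: Aoki1983, Thm. A′ (§7)]); statement: line `cancel-by-any-claim-lattice` ∕ cell hodge-nonav P1 g33; not in print) -/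
theorem exists_fibre_of_not_paired_general₂ {p₁ : ℕ} (hp₁ : p₁.Prime) (hp₁11 : 11 ≤ p₁) {m : ℕ} [NeZero m]
    (hmin : ∀ q ∈ m.primeFactors, p₁ ≤ q) (hsq : ¬ p₁ * p₁ ∣ m) (hsq₂ : ¬ (p₁ + 2) * (p₁ + 2) ∣ m)
    {s : Multiset (ZMod m)} (hs : IsHodgeMultiset s) (h6 : Multiset.card s = p₁ + 1)
    (hns : ∃ x : ZMod m, Multiset.count x s ≠ Multiset.count (-x) s) :
    p₁ ∣ m ∧ ∃ A : ZMod m, (p₁ : ZMod m) * A ≠ 0 ∧ ∃ j₀ : ℕ, j₀ < p₁ ∧ ∀ j : ℕ, j < p₁ → j ≠ j₀ → A + (j : ZMod m) * ((m / p₁ : ℕ) : ZMod m) ∈ s := by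
  have hp₁5 : 5 ≤ p₁ := le_trans (by norm_num) hp₁11
  classical
  have hm0 : m ≠ 0 := NeZero.ne m
  obtain ⟨r, α, hα, rfl⟩ := hs.exists_isHodge
  have hr : r = p₁ + 1 := by rw [card_univ_val_map] at h6; exact h6
  subst hr
  -- the non-even level of some entry
  obtain ⟨x, hx⟩ := hns
  rw [count_univ_val_map, count_univ_val_map] at hx
  have hx0 : x ≠ 0 := by
    rintro rfl
    rw [neg_zero] at hx
    exact hx rfl
  have hfibre : ∀ (M : ℕ) (y : ZMod m), m / m.gcd y.val = M →
      (univ.filter fun i : Fin (p₁ + 1) ↦ α i = y) =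
        univ.filter fun i : Fin (p₁ + 1) ↦ m / m.gcd (α i).val = M ∧
          ((((α i).val / (m / M)) : ℕ) : ZMod M) = (((y.val / (m / M)) : ℕ) : ZMod M) := by
    intro M y hy
    ext i
    simp only [mem_filter, mem_univ, true_and]
    constructor
    · rintro rfl; exact ⟨hy, rfl⟩
    · rintro ⟨hli, hri⟩
      exact eq_of_level_eq_of_unitPart_eq hli hy hri
  set P : ℕ → Prop := fun d ↦ ∃ M : ℕ, M ∣ m ∧ m / M = d ∧ ∃ v : ZMod M,
      #(univ.filter fun i : Fin (p₁ + 1) ↦ m / m.gcd (α i).val = M ∧ ((((α i).val / (m / M)) : ℕ) : ZMod M) = -v) ≠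
      #(univ.filter fun i : Fin (p₁ + 1) ↦ m / m.gcd (α i).val = M ∧ ((((α i).val / (m / M)) : ℕ) : ZMod M) = v) with hP
  have hPex : ∃ d, P d := by
    refine ⟨m / (m / m.gcd x.val), m / m.gcd x.val, level_dvd x, rfl, (((x.val / (m / (m / m.gcd x.val))) : ℕ)), ?_⟩
    rw [← unitPart_neg hx0 rfl, ← hfibre _ (-x) (level_neg x), ← hfibre _ x rfl]
    exact Ne.symm hx
  -- the top non-even level `M` (least `d = m / M`)
  obtain ⟨M, hMm, hdM, hne⟩ := Nat.find_spec hPex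
  have hM0 : M ≠ 0 := fun h0 ↦ hm0 (by rw [h0] at hMm; exact zero_dvd_iff.mp hMm)
  have hIH : ∀ M' : ℕ, M' ∣ m → M ∣ M' → M' ≠ M → ∀ u : ZMod M',
      #(univ.filter fun i : Fin (p₁ + 1) ↦ m / m.gcd (α i).val = M' ∧ ((((α i).val / (m / M')) : ℕ) : ZMod M') = -u) =
      #(univ.filter fun i : Fin (p₁ + 1) ↦ m / m.gcd (α i).val = M' ∧ ((((α i).val / (m / M')) : ℕ) : ZMod M') = u) := by
    intro M' hM'm hMM' hneM u
    have hM'0 : M' ≠ 0 := fun h0 ↦ hm0 (by rw [h0] at hM'm; exact zero_dvd_iff.mp hM'm)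
    have hlt : m / M' < Nat.find hPex := by
      rw [← hdM]
      obtain ⟨t, rfl⟩ := hMM'
      obtain ⟨s', hs'⟩ := hM'm
      have ht1 : t ≠ 1 := fun h1 ↦ hneM (by rw [h1, mul_one])
      have ht0 : t ≠ 0 := fun h0 ↦ hM'0 (by rw [h0, mul_zero])
      have hs0 : 0 < s' := Nat.pos_of_ne_zero fun h0 ↦ hm0 (by rw [hs', h0, mul_zero])
      have h1 : m / (M * t) = s' := by rw [hs', Nat.mul_div_cancel_left _ (Nat.pos_of_ne_zero hM'0)]
      have h2 : m / M = t * s' := by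
        rw [hs', mul_assoc, Nat.mul_div_cancel_left _ (Nat.pos_of_ne_zero hM0)]
      rw [h1, h2]
      calc s' = 1 * s' := (one_mul s').symm
        _ < t * s' := Nat.mul_lt_mul_of_lt_of_le (by omega) (le_refl s') hs0
    have hmin := Nat.find_min hPex hlt
    simp only [hP, not_exists, not_and, not_not] at hmin
    exact hmin M' hM'm rfl u
  obtain ⟨n, hc, hMn, hn1, b, hbu, hfib⟩ := fibre_of_top_level_general₂ hp₁ hp₁5 hp₁11 rfl hmin hsq hsq₂ hα hMm hne hIH
  subst hMn
  have hn0 : n ≠ 0 := by omega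
  haveI : NeZero n := ⟨hn0⟩
  have hp0 : p₁ ≠ 0 := hp₁.ne_zero
  haveI : NeZero p₁ := ⟨hp0⟩
  have hpm : p₁ ∣ m := (dvd_mul_right p₁ n).trans hMm
  obtain ⟨k, hk⟩ := hMm
  have hk0 : k ≠ 0 := fun h0 ↦ hm0 (by rw [hk, h0, mul_zero])
  have hdivpn : m / (p₁ * n) = k := by rw [hk, Nat.mul_div_cancel_left _ (by positivity)]
  have hdivp : m / p₁ = n * k := by rw [hk, mul_assoc, Nat.mul_div_cancel_left _ hp₁.pos]
  have hdivn : m / n = p₁ * k := by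
    rw [hk, show p₁ * n * k = n * (p₁ * k) by ring, Nat.mul_div_cancel_left _ (Nat.pos_of_ne_zero hn0)]
  -- the base point `x₀ = crt⁻¹(0, b)` and `A = (m/(p₁ n))·⟨x₀⟩`
  set x₀ : ZMod (p₁ * n) := (ZMod.chineseRemainder hc).symm (0, b) with hx₀
  refine ⟨hpm, ((m / (p₁ * n) : ℕ) : ZMod m) * ((x₀.val : ℕ) : ZMod m), ?_, 0, hp₁.pos, fun j hj hj0 ↦ ?_⟩
  · -- `p₁ A ≠ 0`: `p₁ A = (m/n)·⟨x₀⟩` and `n ∤ ⟨x₀⟩` as `x₀ ≡ b (mod n)`, `b` a unit, `n > 1`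
    intro h0
    have h5A : (p₁ : ZMod m) * (((m / (p₁ * n) : ℕ) : ZMod m) * ((x₀.val : ℕ) : ZMod m)) =
        ((m / n * x₀.val : ℕ) : ZMod m) := by
      rw [hdivn, hdivpn]; push_cast; ring
    rw [h5A, divMul_natCast_eq_zero_iff ((dvd_mul_left n p₁).trans ⟨k, hk⟩)] at h0
    have hb : (ZMod.castHom (dvd_mul_left n p₁) (ZMod n)) x₀ = b := (castHom_crt_symm hc 0 b).2
    rw [ZMod.castHom_apply, ZMod.cast_eq_val, (ZMod.natCast_eq_zero_iff _ _).mpr h0] at hb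
    haveI : Fact (1 < n) := ⟨hn1⟩
    exact hbu.ne_zero hb.symm
  · -- the point `A + j(m/p₁)` is the entry above `crt⁻¹(jn, b)`
    have hjn5 : ¬ p₁ ∣ j * n := fun hd ↦ by
      rcases (Nat.Prime.dvd_mul hp₁).mp hd with hd | hd
      · exact absurd (Nat.le_of_dvd (by omega) hd) (by omega)
      · exact (Nat.Prime.coprime_iff_not_dvd hp₁).mp hc hd
    have hy0 : ((j * n : ℕ) : ZMod p₁) ≠ 0 := by rwa [Ne, ZMod.natCast_eq_zero_iff]
    haveI : Fact (Nat.Prime p₁) := ⟨hp₁⟩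
    have hyu : IsUnit ((j * n : ℕ) : ZMod p₁) := isUnit_iff_ne_zero.mpr hy0
    obtain ⟨i, hlev, hup⟩ := hfib hyu.unit
    rw [IsUnit.unit_spec] at hup
    -- `crt⁻¹(jn, b) = x₀ + jn`
    have hxj : (ZMod.chineseRemainder hc).symm (((j * n : ℕ) : ZMod p₁), b) =
        x₀ + ((j * n : ℕ) : ZMod (p₁ * n)) := by
      have h1 : ZMod.castHom (dvd_mul_right p₁ n) (ZMod p₁) (x₀ + ((j * n : ℕ) : ZMod (p₁ * n))) =
          ((j * n : ℕ) : ZMod p₁) := by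
        rw [map_add, map_natCast, hx₀, (castHom_crt_symm hc 0 b).1, zero_add]
      have h2 : ZMod.castHom (dvd_mul_left n p₁) (ZMod n) (x₀ + ((j * n : ℕ) : ZMod (p₁ * n))) = b := by
        rw [map_add, map_natCast, hx₀, (castHom_crt_symm hc 0 b).2, Nat.cast_mul, ZMod.natCast_self, mul_zero,
          add_zero]
      rw [← h1, ← h2]
      exact crt_symm_castHom hc _
    have hαi : α i = ((m / (p₁ * n) : ℕ) : ZMod m) * ((x₀.val : ℕ) : ZMod m) +
        (j : ZMod m) * ((m / p₁ : ℕ) : ZMod m) := by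
      rw [eq_divMul_unitPart hlev, hup, hxj, divMul_val_add ⟨k, hk⟩]
      congr 1
      have hval : (((j * n : ℕ) : ZMod (p₁ * n))).val = j * n := by
        rw [ZMod.val_natCast, Nat.mod_eq_of_lt (by nlinarith [Nat.pos_of_ne_zero hn0])]
      rw [hval, hdivpn, hdivp]
      push_cast
      ring
    rw [← hαi]
    exact Multiset.mem_map_of_mem _ (Finset.mem_univ_val i)


end ProgressionGeneralTwin

end PairedNull

end Summit.HodgeConjecture.HodgeConjecture.Theorems.CancelByAnyClaimLattice

end
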